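import Summits.ValiantsHypothesis.ValiantsHypothesis.Theorems.SymPencilPerFourRowPairing
import Summits.ValiantsHypothesis.ValiantsHypothesis.Theorems.SymPencilPerFourPairingHyperplane
import Summits.ValiantsHypothesis.ValiantsHypothesis.Theorems.SymPencilPerFourLowRankSeven
import Summits.ValiantsHypothesis.ValiantsHypothesis.Theorems.SymPencilBoxFourSeven

/-!
# Route `SymPencil` — no `7`-dimensional singular subspace of `per_4` has `rank Hess per_4 ≤ 7`
# (the sharp form of Task T1; closes the case `(r, dim V) = (9, 7)` of the kernel package for the
# sizes `m = 25, 26`; `--supports` stmt-ValiantsHypothesis-5674 `SdcSuperquadratic`; rung currency)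

**Theorem** (`not_sum_sq_swap_seven₈`).  Over a field of characteristic `0`, along a
`7`-dimensional linear subspace `V ⊆ Sing Z(per_4)` not every direction `y` has the SWAPPED
property with `< 8` squares (the `s²`-coefficient of `per_4 (u + s y)` equal to
`Σ_{k<8} c_k Λ_k(u)²` for all `u`, i.e. `rank (Hess per_4)(y) ≤ 7`).  This is sharp: on a hyperplane
of a two-row block the rank is identically `8`.  (`SymPencilPerFourLowRankSeven`: the same with
`< 6` squares.)

Proof, by the trichotomy `SymPencilBoxFourSeven.seven_trichotomy_iff` (val-width-5676-p2 g3):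
* DETECTING PAIR of rows `p, q` (`false_of_detecting_rows_of_sum_sq_swap₈`): for `u` on the
  complementary rows the `s²`-coefficient is the eight-cell ROW PAIRING, which `< 8` squares make
  degenerate, so the pairing discriminant `A·B - 4Π` of rows `p, q` vanishes at every `y ∈ V`
  (`SymPencilPerFourRowPairing.pairingDisc_eq_of_sum_sq_swap`); rows `p, q` map `V` injectively
  onto a `7`-dimensional `V' ≤ K⁴ × K⁴` on which the discriminant vanishes — impossible
  (`SymPencilPerFourPairingHyperplane.false_of_pairingDisc_vanish`).  Columns: transpose.
* CROSS `X_{lc}` (`false_of_cross_of_sum_sq_swap₉`, even `< 9` squares): at the indicator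
  `y₀ = 𝟙_{row l ∪ col c} ∈ V` and `u` supported on the complementary `3 × 3` block `x`,
  `per_4 (u + s y₀) = s·per_3(x) + s²·Q(x)` with `Q(x) = Σ` (products of two entries of `x` in
  different rows and columns), a quadratic form of RANK `9` (matrix `½ (J-I) ⊗ (J-I)`, inverse
  `2 (J-2I) ⊗ (J-2I)`): fewer than `9` squares cannot represent it.

Consequence for the lane (`Cruxes/SdcSuperquadratic/NEXT-RUNG-25.md`): in the two-sided kernel
package at `m = 25, 26` the case `r = 9` (`dim V = 7`, defect `6, 7`) is impossible; the remaining
cells at `m = 25` are `(8,8,8)`, `(10,6,4)`, `(12,4,0)`.  Honest framing: a lemma about `4 × 4`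
matrices; the tree's bound stays `sdc(per_4) ≥ 25`; the crux `SdcSuperquadratic` and `VP ≠ VNP` are
untouched.  No definitions, no named facts. [folklore]
-/

noncomputable section

-- single-conjunct layout: Sub = Summit, duplicated namespace component intended
set_option linter.dupNamespace false

namespace Summit.ValiantsHypothesis.ValiantsHypothesis.Theorems.SymPencilPerFourLowRankSevenSharp

open Matrix MvPolynomial Finset Module
open Literature.Computability.AlgebraicComplexity
open Literature.Computability.AlgebraicComplexity.AlperBogartVelasco
open Summit.ValiantsHypothesis.ValiantsHypothesis.Theorems.SymPencilPerFourBlocks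
open Summit.ValiantsHypothesis.ValiantsHypothesis.Theorems.SymPencilPerFourHessianBlocks
open Summit.ValiantsHypothesis.ValiantsHypothesis.Theorems.SymPencilPerFourRowPairing
open Summit.ValiantsHypothesis.ValiantsHypothesis.Theorems.SymPencilPerFourPairingHyperplane
open Summit.ValiantsHypothesis.ValiantsHypothesis.Theorems.SymPencilPerFourLowRankSeven
open Summit.ValiantsHypothesis.ValiantsHypothesis.Theorems.SymPencilPerFourTwoRowsRadical
open Summit.ValiantsHypothesis.ValiantsHypothesis.Theorems.SymPencilBoxFourSeven

variable {K : Type*} [Field K]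

/-! ### A detecting pair of rows or columns -/

/-- **Detecting rows and `rank Hess ≤ 7` are incompatible in dimension `≥ 7`.**  If `dim W ≥ 7`,
rows `p ≠ q` detect `W`, and every `y ∈ W` has the swapped property with `|ι| < 8` squares,
contradiction.  See the module docstring. [folklore] -/
theorem false_of_detecting_rows_of_sum_sq_swap₈ [CharZero K] {ι : Type*} [Fintype ι]
    (hι : Fintype.card ι < 8) (W : Submodule K (Fin 4 × Fin 4 → K)) (h7 : 7 ≤ finrank K W)
    {p q : Fin 4} (hpq : p ≠ q)
    (hdet : ∀ x ∈ W, (∀ j, x (p, j) = 0) → (∀ j, x (q, j) = 0) → x = 0)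
    (hW : ∀ y ∈ W, ∃ (c : ι → K) (Λ : ι → ((Fin 4 × Fin 4 → K) →ₗ[K] K)),
      ∀ u : Fin 4 × Fin 4 → K, ∃ e₀ e₁ : K, ∀ s : K,
        eval (u + s • y) (perPoly (Fin 4) K) = e₀ + s * e₁ + s ^ 2 * ∑ k, c k * (Λ k u) ^ 2) :
    False := by
  classical
  -- rows `p, q` as a point of `K⁴ × K⁴ = K^{Fin 4 ⊕ Fin 4}`
  let φ : (Fin 4 × Fin 4 → K) →ₗ[K] (Fin 4 ⊕ Fin 4 → K) :=
    LinearMap.pi fun t => LinearMap.proj (Sum.elim (fun i => (p, i)) (fun i => (q, i)) t)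
  have hφl : ∀ x i, φ x (Sum.inl i) = x (p, i) := fun _ _ => rfl
  have hφr : ∀ x i, φ x (Sum.inr i) = x (q, i) := fun _ _ => rfl
  set V' := W.map φ with hV'def
  have hker : (W ⊓ LinearMap.ker φ : Submodule K _) = ⊥ := by
    rw [eq_bot_iff]
    intro x hx
    rw [Submodule.mem_inf, LinearMap.mem_ker] at hx
    rw [Submodule.mem_bot]
    refine hdet x hx.1 (fun j => ?_) (fun j => ?_)
    · have h0 : φ x (Sum.inl j) = 0 := by rw [hx.2]; rfl
      rwa [hφl] at h0
    · have h0 : φ x (Sum.inr j) = 0 := by rw [hx.2]; rfl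
      rwa [hφr] at h0
  have h7' : 7 ≤ finrank K V' := by
    have h := finrank_eq_finrank_map_add_finrank_inf_ker W φ
    rw [hker, finrank_bot, add_zero] at h
    rw [hV'def, ← h]; exact h7
  refine false_of_pairingDisc_vanish V' h7' ?_
  rintro _ ⟨x, hx, rfl⟩
  simp only [hφl, hφr]
  exact pairingDisc_eq_of_sum_sq_swap hι x (hW x hx) hpq

/-- **Detecting columns and `rank Hess ≤ 7` are incompatible in dimension `≥ 7`** (transpose of
`false_of_detecting_rows_of_sum_sq_swap₈`). [folklore] -/
theorem false_of_detecting_cols_of_sum_sq_swap₈ [CharZero K] {ι : Type*} [Fintype ι]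
    (hι : Fintype.card ι < 8) (W : Submodule K (Fin 4 × Fin 4 → K)) (h7 : 7 ≤ finrank K W)
    {p q : Fin 4} (hpq : p ≠ q)
    (hdet : ∀ x ∈ W, (∀ i, x (i, p) = 0) → (∀ i, x (i, q) = 0) → x = 0)
    (hW : ∀ y ∈ W, ∃ (c : ι → K) (Λ : ι → ((Fin 4 × Fin 4 → K) →ₗ[K] K)),
      ∀ u : Fin 4 × Fin 4 → K, ∃ e₀ e₁ : K, ∀ s : K,
        eval (u + s • y) (perPoly (Fin 4) K) = e₀ + s * e₁ + s ^ 2 * ∑ k, c k * (Λ k u) ^ 2) :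
    False := by
  set Φ : (Fin 4 × Fin 4 → K) ≃ₗ[K] (Fin 4 × Fin 4 → K) :=
    LinearEquiv.funCongrLeft K K (Equiv.prodComm (Fin 4) (Fin 4)) with hΦ
  have hW' := sqFamilySwap_map W Φ eval_perPoly_transpose hW
  set W' := W.map Φ.toLinearMap with hW'def
  have hfin : finrank K W' = finrank K W := by rw [hW'def, LinearEquiv.finrank_map_eq]
  have hdet' : ∀ y ∈ W', (∀ j, y (p, j) = 0) → (∀ j, y (q, j) = 0) → y = 0 := by
    rintro _ ⟨x, hx, rfl⟩ h2 h3
    have hx0 : x = 0 := hdet x hx (fun i => h2 i) (fun i => h3 i)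
    rw [hx0, map_zero]
  exact false_of_detecting_rows_of_sum_sq_swap₈ hι W' (by rw [hfin]; exact h7) hpq hdet' hW'

/-! ### A cross: the `s²`-coefficient at the indicator has rank `9` -/

/-- **`per_4 (u + s y₀)` for the cross indicator `y₀ = 𝟙_{row 3 ∪ col 3}` and `u` supported on the
`3 × 3` block `{0,1,2}²`** (`u_{ij} = x_{ij}`): `s · per_3(x) + s² · Q(x)`, `Q(x)` the sum of the
products of two entries of `x` in different rows and different columns. [folklore] -/
theorem eval_perPoly_block_add_smul_cross (x : Fin 3 × Fin 3 → K) (s : K) :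
    eval ((fun p : Fin 4 × Fin 4 => if p = (0, 0) then x (0, 0) else if p = (0, 1) then x (0, 1) else if p = (0, 2) then x (0, 2) else if p = (1, 0) then x (1, 0) else if p = (1, 1) then x (1, 1) else if p = (1, 2) then x (1, 2) else if p = (2, 0) then x (2, 0) else if p = (2, 1) then x (2, 1) else if p = (2, 2) then x (2, 2) else 0) +
        s • (fun p : Fin 4 × Fin 4 => if p.1 = 3 ∨ p.2 = 3 then (1 : K) else 0))
        (perPoly (Fin 4) K) =
      s * (x (0, 0) * x (1, 1) * x (2, 2) +
      x (0, 0) * x (1, 2) * x (2, 1) +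
      x (0, 1) * x (1, 0) * x (2, 2) +
      x (0, 1) * x (1, 2) * x (2, 0) +
      x (0, 2) * x (1, 0) * x (2, 1) +
      x (0, 2) * x (1, 1) * x (2, 0)) +
      s ^ 2 * (x (0, 0) * x (1, 1) +
      x (0, 0) * x (1, 2) +
      x (0, 0) * x (2, 1) +
      x (0, 0) * x (2, 2) +
      x (0, 1) * x (1, 0) +
      x (0, 1) * x (1, 2) +
      x (0, 1) * x (2, 0) +
      x (0, 1) * x (2, 2) +
      x (0, 2) * x (1, 0) +
      x (0, 2) * x (1, 1) +
      x (0, 2) * x (2, 0) +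
      x (0, 2) * x (2, 1) +
      x (1, 0) * x (2, 1) +
      x (1, 0) * x (2, 2) +
      x (1, 1) * x (2, 0) +
      x (1, 1) * x (2, 2) +
      x (1, 2) * x (2, 0) +
      x (1, 2) * x (2, 1)) := by
  rw [eval_perPoly, Matrix.permanent_fin_four_row]
  simp only [Matrix.of_apply, Pi.add_apply, Pi.smul_apply, smul_eq_mul, Prod.mk.injEq,
    show ((1 : Fin 4) = 0) = False by decide, show ((2 : Fin 4) = 0) = False by decide,
    show ((3 : Fin 4) = 0) = False by decide, show ((0 : Fin 4) = 1) = False by decide,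
    show ((2 : Fin 4) = 1) = False by decide, show ((3 : Fin 4) = 1) = False by decide,
    show ((0 : Fin 4) = 2) = False by decide, show ((1 : Fin 4) = 2) = False by decide,
    show ((3 : Fin 4) = 2) = False by decide, show ((0 : Fin 4) = 3) = False by decide,
    show ((1 : Fin 4) = 3) = False by decide, show ((2 : Fin 4) = 3) = False by decide,
    and_true, and_false, or_true, or_false,
    if_true, if_false, and_self, or_self, mul_one, mul_zero, zero_add, add_zero]
  ring

set_option maxHeartbeats 400000 in
/-- **The cross indicator admits no swapped family with `< 9` squares**: the quadratic form `Q` on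
the nine block cells is non-degenerate (`(J-I) ⊗ (J-I)` is invertible in characteristic `0`).
[folklore] -/
theorem false_of_sum_sq_swap_cross33 [CharZero K] {ι : Type*} [Fintype ι]
    (hι : Fintype.card ι < 9) (c : ι → K) (Λ : ι → ((Fin 4 × Fin 4 → K) →ₗ[K] K))
    (h : ∀ u : Fin 4 × Fin 4 → K, ∃ e₀ e₁ : K, ∀ s : K,
      eval (u + s • (fun p : Fin 4 × Fin 4 => if p.1 = 3 ∨ p.2 = 3 then (1 : K) else 0))
        (perPoly (Fin 4) K) = e₀ + s * e₁ + s ^ 2 * ∑ k, c k * (Λ k u) ^ 2) : False := by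
  classical
  -- the nine-parameter family of base points, linear in `x`
  let coeff : Fin 4 × Fin 4 → ((Fin 3 × Fin 3 → K) →ₗ[K] K) := fun p =>
    if p = (0, 0) then LinearMap.proj (0, 0) else if p = (0, 1) then LinearMap.proj (0, 1) else
    if p = (0, 2) then LinearMap.proj (0, 2) else if p = (1, 0) then LinearMap.proj (1, 0) else
    if p = (1, 1) then LinearMap.proj (1, 1) else if p = (1, 2) then LinearMap.proj (1, 2) else
    if p = (2, 0) then LinearMap.proj (2, 0) else if p = (2, 1) then LinearMap.proj (2, 1) else
    if p = (2, 2) then LinearMap.proj (2, 2) else 0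
  let U : (Fin 3 × Fin 3 → K) →ₗ[K] (Fin 4 × Fin 4 → K) := LinearMap.pi coeff
  have hU : ∀ x : Fin 3 × Fin 3 → K, U x = fun p => if p = (0, 0) then x (0, 0) else if p = (0, 1) then x (0, 1) else if p = (0, 2) then x (0, 2) else if p = (1, 0) then x (1, 0) else if p = (1, 1) then x (1, 1) else if p = (1, 2) then x (1, 2) else if p = (2, 0) then x (2, 0) else if p = (2, 1) then x (2, 1) else if p = (2, 2) then x (2, 2) else 0 := by
    intro x
    ext p
    simp only [U, LinearMap.pi_apply, coeff]
    split_ifs <;> rfl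
  set Qf : (Fin 3 × Fin 3 → K) → K := fun x => x (0, 0) * x (1, 1) +
      x (0, 0) * x (1, 2) +
      x (0, 0) * x (2, 1) +
      x (0, 0) * x (2, 2) +
      x (0, 1) * x (1, 0) +
      x (0, 1) * x (1, 2) +
      x (0, 1) * x (2, 0) +
      x (0, 1) * x (2, 2) +
      x (0, 2) * x (1, 0) +
      x (0, 2) * x (1, 1) +
      x (0, 2) * x (2, 0) +
      x (0, 2) * x (2, 1) +
      x (1, 0) * x (2, 1) +
      x (1, 0) * x (2, 2) +
      x (1, 1) * x (2, 0) +
      x (1, 1) * x (2, 2) +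
      x (1, 2) * x (2, 0) +
      x (1, 2) * x (2, 1) with hQf
  -- the `s²`-coefficient along the family is `Q`
  have hS : ∀ x, ∑ k, c k * (Λ k (U x)) ^ 2 = Qf x := by
    intro x
    obtain ⟨e₀, e₁, he⟩ := h (U x)
    refine coeff_two_eq_of_forall (e₀ := e₀) (e₁ := e₁ - (x (0, 0) * x (1, 1) * x (2, 2) +
      x (0, 0) * x (1, 2) * x (2, 1) +
      x (0, 1) * x (1, 0) * x (2, 2) +
      x (0, 1) * x (1, 2) * x (2, 0) +
      x (0, 2) * x (1, 0) * x (2, 1) +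
      x (0, 2) * x (1, 1) * x (2, 0))) (c₃ := 0) (c₄ := 0) fun s => ?_
    have hc : eval (U x + s • (fun p : Fin 4 × Fin 4 => if p.1 = 3 ∨ p.2 = 3 then (1 : K) else 0))
        (perPoly (Fin 4) K) = s * (x (0, 0) * x (1, 1) * x (2, 2) +
      x (0, 0) * x (1, 2) * x (2, 1) +
      x (0, 1) * x (1, 0) * x (2, 2) +
      x (0, 1) * x (1, 2) * x (2, 0) +
      x (0, 2) * x (1, 0) * x (2, 1) +
      x (0, 2) * x (1, 1) * x (2, 0)) + s ^ 2 * Qf x := by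
      rw [hU]; exact eval_perPoly_block_add_smul_cross x s
    linear_combination hc - he s
  -- a common-kernel vector of the `Λ_k ∘ U` (nine parameters, fewer than nine functionals)
  let M : (Fin 3 × Fin 3 → K) →ₗ[K] (ι → K) := LinearMap.pi fun k => (Λ k).comp U
  have hM : ∀ x k, M x k = Λ k (U x) := fun x k => rfl
  have hker : LinearMap.ker M ≠ ⊥ := LinearMap.ker_ne_bot_of_finrank_lt (by
    rw [Module.finrank_fintype_fun_eq_card, Module.finrank_fintype_fun_eq_card,
      Fintype.card_prod, Fintype.card_fin]
    omega)
  obtain ⟨n, hn, hn0⟩ := Submodule.exists_mem_ne_zero_of_ne_bot hker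
  have hΛ0 : ∀ k, Λ k (U n) = 0 := fun k => by
    have := congr_fun (LinearMap.mem_ker.1 hn) k
    rwa [hM] at this
  have hinv : ∀ x, Qf (n + x) = Qf x := by
    intro x
    have h1 := hS (n + x)
    simp only [map_add, hΛ0, zero_add] at h1
    rw [hS x] at h1
    exact h1.symm
  have hQ0 : Qf n = 0 := by
    have h0 := hinv 0
    rw [add_zero] at h0
    rw [h0]
    simp [hQf]
  have hsingle : ∀ (a b : Fin 3 × Fin 3), (Pi.single a (1 : K) : Fin 3 × Fin 3 → K) b =
      if b = a then 1 else 0 := fun a b => by rw [Pi.single_apply]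
  -- the nine polar identities `Σ_{a'≠a, b'≠b} n_{a'b'} = 0`
  have g00 := hinv (Pi.single (0, 0) 1)
  have g01 := hinv (Pi.single (0, 1) 1)
  have g02 := hinv (Pi.single (0, 2) 1)
  have g10 := hinv (Pi.single (1, 0) 1)
  have g11 := hinv (Pi.single (1, 1) 1)
  have g12 := hinv (Pi.single (1, 2) 1)
  have g20 := hinv (Pi.single (2, 0) 1)
  have g21 := hinv (Pi.single (2, 1) 1)
  have g22 := hinv (Pi.single (2, 2) 1)
  simp only [hQf, Pi.add_apply, hsingle, Prod.mk.injEq,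
    show ((1 : Fin 3) = 0) = False by decide, show ((2 : Fin 3) = 0) = False by decide,
    show ((0 : Fin 3) = 1) = False by decide, show ((2 : Fin 3) = 1) = False by decide,
    show ((0 : Fin 3) = 2) = False by decide, show ((1 : Fin 3) = 2) = False by decide,
    and_true, and_false, if_true, if_false, and_self,
    mul_one, mul_zero, add_zero] at g00 g01 g02 g10 g11 g12 g20 g21 g22
  simp only [hQf] at hQ0
  -- the nine linear identities `Σ_{a'≠a, b'≠b} n_{a'b'} = 0`
  have L00 : n (1, 1) + n (1, 2) + n (2, 1) + n (2, 2) = 0 := by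
    linear_combination g00 - hQ0
  have L01 : n (1, 0) + n (1, 2) + n (2, 0) + n (2, 2) = 0 := by
    linear_combination g01 - hQ0
  have L02 : n (1, 0) + n (1, 1) + n (2, 0) + n (2, 1) = 0 := by
    linear_combination g02 - hQ0
  have L10 : n (0, 1) + n (0, 2) + n (2, 1) + n (2, 2) = 0 := by
    linear_combination g10 - hQ0
  have L11 : n (0, 0) + n (0, 2) + n (2, 0) + n (2, 2) = 0 := by
    linear_combination g11 - hQ0
  have L12 : n (0, 0) + n (0, 1) + n (2, 0) + n (2, 1) = 0 := by
    linear_combination g12 - hQ0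
  have L20 : n (0, 1) + n (0, 2) + n (1, 1) + n (1, 2) = 0 := by
    linear_combination g20 - hQ0
  have L21 : n (0, 0) + n (0, 2) + n (1, 0) + n (1, 2) = 0 := by
    linear_combination g21 - hQ0
  have L22 : n (0, 0) + n (0, 1) + n (1, 0) + n (1, 1) = 0 := by
    linear_combination g22 - hQ0
  apply hn0
  ext ⟨a, b⟩
  fin_cases a <;> fin_cases b
  · show n (0, 0) = 0
    linear_combination (1 / 4 : K) * (L00 - L01 - L02 - L10 + L11 + L12 - L20 + L21 + L22)
  · show n (0, 1) = 0
    linear_combination (1 / 4 : K) * (- L00 + L01 - L02 + L10 - L11 + L12 + L20 - L21 + L22)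
  · show n (0, 2) = 0
    linear_combination (1 / 4 : K) * (- L00 - L01 + L02 + L10 + L11 - L12 + L20 + L21 - L22)
  · show n (1, 0) = 0
    linear_combination (1 / 4 : K) * (- L00 + L01 + L02 + L10 - L11 - L12 - L20 + L21 + L22)
  · show n (1, 1) = 0
    linear_combination (1 / 4 : K) * (L00 - L01 + L02 - L10 + L11 - L12 + L20 - L21 + L22)
  · show n (1, 2) = 0
    linear_combination (1 / 4 : K) * (L00 + L01 - L02 - L10 - L11 + L12 + L20 + L21 - L22)
  · show n (2, 0) = 0
    linear_combination (1 / 4 : K) * (- L00 + L01 + L02 - L10 + L11 + L12 + L20 - L21 - L22)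
  · show n (2, 1) = 0
    linear_combination (1 / 4 : K) * (L00 - L01 + L02 + L10 - L11 + L12 - L20 + L21 - L22)
  · show n (2, 2) = 0
    linear_combination (1 / 4 : K) * (L00 + L01 - L02 + L10 + L11 - L12 - L20 - L21 + L22)

/-- **A cross admits no swapped family with `< 9` squares.**  If `W` is the cross `X_{lc}` and
every `y ∈ W` has the swapped property with `|ι| < 9` squares, contradiction (transport of
`false_of_sum_sq_swap_cross33` by row/column permutations). [folklore] -/
theorem false_of_cross_of_sum_sq_swap₉ [CharZero K] {ι : Type*} [Fintype ι]
    (hι : Fintype.card ι < 9) (W : Submodule K (Fin 4 × Fin 4 → K)) {l c : Fin 4}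
    (hX : ∀ x, x ∈ W ↔ ∀ i j : Fin 4, i ≠ l → j ≠ c → x (i, j) = 0)
    (hW : ∀ y ∈ W, ∃ (c : ι → K) (Λ : ι → ((Fin 4 × Fin 4 → K) →ₗ[K] K)),
      ∀ u : Fin 4 × Fin 4 → K, ∃ e₀ e₁ : K, ∀ s : K,
        eval (u + s • y) (perPoly (Fin 4) K) = e₀ + s * e₁ + s ^ 2 * ∑ k, c k * (Λ k u) ^ 2) :
    False := by
  classical
  -- the indicator of the cross
  set y₀ : Fin 4 × Fin 4 → K := fun p => if p.1 = l ∨ p.2 = c then 1 else 0 with hy₀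
  have hy₀W : y₀ ∈ W := by
    rw [hX]
    intro i j hi hj
    simp [hy₀, hi, hj]
  obtain ⟨c', Λ, hcΛ⟩ := hW y₀ hy₀W
  set σ : Equiv.Perm (Fin 4) := Equiv.swap 3 l with hσ
  set τ : Equiv.Perm (Fin 4) := Equiv.swap 3 c with hτ
  set e := Equiv.prodCongr σ τ with he
  have h' : ∀ u : Fin 4 × Fin 4 → K, ∃ e₀ e₁ : K, ∀ s : K,
      eval (u + s • (y₀ ∘ e)) (perPoly (Fin 4) K) =
        e₀ + s * e₁ + s ^ 2 * ∑ k, c' k * ((Λ k).comp (LinearMap.funLeft K K e.symm) u) ^ 2 := by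
    intro u
    obtain ⟨e₀, e₁, hu⟩ := hcΛ (u ∘ e.symm)
    refine ⟨e₀, e₁, fun s => ?_⟩
    have hcomp : u + s • (y₀ ∘ e) = (u ∘ e.symm + s • y₀) ∘ e := by
      ext x
      simp
    rw [hcomp, he, eval_perPoly_comp_prodCongr, ← he, hu s]
    rfl
  have hye : y₀ ∘ e = fun p : Fin 4 × Fin 4 => if p.1 = 3 ∨ p.2 = 3 then (1 : K) else 0 := by
    ext ⟨i, j⟩
    simp only [Function.comp_apply, he, Equiv.prodCongr_apply, Prod.map_apply, hy₀, hσ, hτ,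
      Equiv.swap_apply_eq_iff, Equiv.swap_apply_right]
  rw [hye] at h'
  exact false_of_sum_sq_swap_cross33 hι c' _ h'

/-! ### Assembly -/

/-- **No `7`-dimensional `V ⊆ Sing Z(per_4)` has `rank (Hess per_4) ≤ 7` on `V`**: not every
`y ∈ V` has the swapped property with `|ι| < 8` squares (weights may depend on `y`).  Sharp:
`8` is attained on hyperplanes of two-row blocks. [folklore] -/
theorem not_sum_sq_swap_seven₈ [CharZero K] {ι : Type*} [Fintype ι] (hι : Fintype.card ι < 8)
    (V : Submodule K (Fin 4 × Fin 4 → K))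
    (hV3 : ∀ x ∈ V, ∀ (r c : Fin 3 → Fin 4), Function.Injective r → Function.Injective c →
      ((Matrix.of fun i j => x (i, j)).submatrix r c).permanent = 0)
    (h7 : finrank K V = 7) :
    ¬ (∀ y ∈ V, ∃ (c : ι → K) (Λ : ι → ((Fin 4 × Fin 4 → K) →ₗ[K] K)),
        ∀ u : Fin 4 × Fin 4 → K, ∃ e₀ e₁ : K, ∀ s : K,
          eval (u + s • y) (perPoly (Fin 4) K) = e₀ + s * e₁ + s ^ 2 * ∑ k, c k * (Λ k u) ^ 2) := by
  intro hW
  rcases seven_trichotomy_iff V hV3 h7 with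
    ⟨p, q, hpq, hdet⟩ | ⟨p, q, hpq, hdet⟩ | ⟨l, c₀, hX⟩
  · exact false_of_detecting_rows_of_sum_sq_swap₈ hι V (by rw [h7]) hpq hdet hW
  · exact false_of_detecting_cols_of_sum_sq_swap₈ hι V (by rw [h7]) hpq hdet hW
  · exact false_of_cross_of_sum_sq_swap₉ (by omega) V hX hW

/-- **Fixed-weights form with `7` squares** (the shape consumed by assemblies on the two-sided
kernel package at `m = 26`): no `7`-dimensional `V ⊆ Sing Z(per_4)` carries, for fixed
`c : Fin 7 → K`, a swapped family of `7`-square expansions. [folklore] -/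
theorem noLowRank_seven₇ [CharZero K] (V : Submodule K (Fin 4 × Fin 4 → K))
    (hV3 : ∀ x ∈ V, ∀ (r c : Fin 3 → Fin 4), Function.Injective r → Function.Injective c →
      ((Matrix.of fun i j => x (i, j)).submatrix r c).permanent = 0)
    (h7 : finrank K V = 7) (c : Fin 7 → K) :
    ¬ (∀ y ∈ V, ∃ Λ : Fin 7 → ((Fin 4 × Fin 4 → K) →ₗ[K] K),
        ∀ u : Fin 4 × Fin 4 → K, ∃ e₀ e₁ : K, ∀ s : K,
          eval (u + s • y) (perPoly (Fin 4) K) = e₀ + s * e₁ + s ^ 2 * ∑ k, c k * (Λ k u) ^ 2) :=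
  fun hform => not_sum_sq_swap_seven₈ (by rw [Fintype.card_fin]; norm_num) V hV3 h7
    fun y hy => ⟨c, hform y hy⟩

/-- **Fixed-weights form with `6` squares** (the case `(r, dim V, d) = (9, 7, 6)` at `m = 25`).
[folklore] -/
theorem noLowRank_seven₆ [CharZero K] (V : Submodule K (Fin 4 × Fin 4 → K))
    (hV3 : ∀ x ∈ V, ∀ (r c : Fin 3 → Fin 4), Function.Injective r → Function.Injective c →
      ((Matrix.of fun i j => x (i, j)).submatrix r c).permanent = 0)
    (h7 : finrank K V = 7) (c : Fin 6 → K) :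
    ¬ (∀ y ∈ V, ∃ Λ : Fin 6 → ((Fin 4 × Fin 4 → K) →ₗ[K] K),
        ∀ u : Fin 4 × Fin 4 → K, ∃ e₀ e₁ : K, ∀ s : K,
          eval (u + s • y) (perPoly (Fin 4) K) = e₀ + s * e₁ + s ^ 2 * ∑ k, c k * (Λ k u) ^ 2) :=
  fun hform => not_sum_sq_swap_seven₈ (by rw [Fintype.card_fin]; norm_num) V hV3 h7
    fun y hy => ⟨c, hform y hy⟩

end Summit.ValiantsHypothesis.ValiantsHypothesis.Theorems.SymPencilPerFourLowRankSevenSharp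

end
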